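import Literature.AlgebraicGeometry.Frobenioids.ArchimedeanUnitTopology
import Literature.AlgebraicGeometry.Frobenioids.ArchimedeanUnitCircleAngular
import HarnessLib

/-!
# Frobenioids II, Remark 3.6.1 ("the topology of `O^×(A) ≅ S¹` is recovered category-theoretically")
# — instance for the ANGULAR Frobenioid `A`, PROVED

Mochizuki, *The geometry of Frobenioids II*, Kyushu J. Math. **62** (2008) 401–460, §3, Remark 3.6.1,
author's kurims text p. 39 ll. 26–28 [cite: MochizukiFrdII2008, Rmk 3.6.1 p.39]: "Note that the
topology of `O^×(A)` (`≅ S¹`), for complex isotropic `A ∈ Ob(C)`, may be recovered from the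
category-theoretic structure of `C` [cf. Theorem 3.6, (vii)] precisely because of the existence of the
non-isotropic objects."  As printed, the remark speaks of `C`.  The theorem it cites, Theorem 3.6,
is stated (preamble, p. 36 ll. 23–24) for "`F` […] one of the following Frobenioids: `C^Λ`, `A`
[where, when `F = A`, we take `Λ = ℤ`]", and its item (vii) (p. 37 l. 33) reads "Suppose that
`Λ = ℤ`. Let `A ∈ Ob(F)` be complex. Then […]" — so (vii) applies to `F = A` as well as to
`F = C`, and this file records the corresponding reading of the remark AT THE ANGULAR FROBENIOID `A`
(an instance of the cell's generic predicate, not an additional claim of the paper; docstring requoted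
with marked elisions per referee finding I10-F2 — docstring-only revision, declarations unchanged).

The generic predicate `ArchFrd.Rmk361` (`ArchimedeanBasicProperties.lean`) was instantiated at `C` only
(`Rmk361_C`, `ArchimedeanTheoremsInstances.lean`; proved in `ArchimedeanUnitTopology.lean`). Here
(statement owner, seat abc-iut-L1-t9) the instance at the angular Frobenioid `A` is STATED (`Rmk361_A`,
same data as `Thm36vii_A`: ambient `ℂ^×`, `∂A` via `bdA`, underlying maps `vMapA`) and PROVED
(`rmk361_A`), together with the group isomorphism `S¹ ≅ O^×(X)` for complex isotropic `X ∈ Ob(A)`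
(`A.circleEquivUnits`, the isomorphism behind `thm36v_isoCircle_A`). No statement of the paper is
strengthened; nothing here bears on [IUTchIII].
-/

namespace Literature.AlgebraicGeometry.Frobenioids

open CategoryTheory

noncomputable section

universe v u

namespace ArchFrd

variable {D : Type u} [Category.{v} D] (π : D ⥤ D0)

/-- **Remark 3.6.1 at the angular Frobenioid `A`** (the reading of the printed remark — which speaks of
`C`, p. 39 ll. 26–28 — at `F = A` of Theorem 3.6 (vii), as a `Prop`; same shape as `Rmk361_C`): for
complex isotropic `X ∈ Ob(A)` and `x₀ ∈ ∂A_X` there is `O^×(X) ≅ S¹` under which the orbit map of `x₀`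
is a topological embedding `S¹ → ℂ^×` with image `∂A_X`. [cite: MochizukiFrdII2008, Rmk 3.6.1 p.39] -/
def Rmk361_A : Prop := Rmk361 (baseRC π) (A.toElem π) .Z (fun X => ambient π X.obj) (bdA π) (vMapA π)

/-- The homomorphism `S¹ → O^×(X)` for complex naively isotropic `X ∈ Ob(A)`.
[cite: MochizukiFrdII2008, Thm 3.6 (v) p.37] -/
def A.circleToUnits (X : A π) (hX : X.obj.fst.IsNaivelyIsotropic) (hc : X.obj.fst.IsComplexObj) :
    Circle →* PreFrobenioid.unitsSubgroup (A.toElem π) X :=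
  (A.circleToAut π X hX hc).codRestrict (PreFrobenioid.unitsSubgroup (A.toElem π) X)
    (fun _ => A.unitAutOver_mem π X hX hc _ _)

/-- `A.circleToUnits` is bijective. [cite: MochizukiFrdII2008, Thm 3.6 (v) p.37] -/
theorem A.circleToUnits_bijective (X : A π) (hX : X.obj.fst.IsNaivelyIsotropic)
    (hc : X.obj.fst.IsComplexObj) : Function.Bijective (A.circleToUnits π X hX hc) := by
  refine ⟨?_, ?_⟩
  · intro z w h
    have h' := congrArg (fun v : PreFrobenioid.unitsSubgroup (A.toElem π) X =>
      C0.scalar (v : Aut X).hom.hom.fst) h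
    change Circle.toUnits z = Circle.toUnits w at h'
    exact Circle.ext (by
      have := congrArg (fun c : ℂˣ => (c : ℂ)) h'
      simpa [Circle.toUnits_apply] using this)
  · rintro ⟨u, hu⟩
    have huC := A.mapIso_mem_unitsSubgroup π X u hu
    have hn := norm_scalar_eq_one_of_mem_unitsSubgroup π X.obj hX ((A.ι π).mapIso u) huC
    refine ⟨⟨((C0.scalar u.hom.hom.fst : ℂˣ) : ℂ), mem_sphere_zero_iff_norm.mpr hn⟩, ?_⟩
    apply Subtype.ext
    change A.unitAutOver π X hX hc _ _ = u
    apply Iso.ext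
    apply WideSubcategory.hom_ext
    have e := congrArg Iso.hom (eq_unitAutOver_of_mem π X.obj hX hc ((A.ι π).mapIso u) huC)
    refine Eq.trans ?_ e.symm
    change (ArchFrd.unitAutOver π X.obj hX hc _ _).hom = (ArchFrd.unitAutOver π X.obj hX hc _ _).hom
    congr 2
    exact Units.ext (by rw [Circle.toUnits_apply, Units.val_mk0]; rfl)

/-- The group isomorphism `S¹ ≅ O^×(X)` for a complex naively isotropic `X ∈ Ob(A)`.
[cite: MochizukiFrdII2008, Thm 3.6 (v) p.37] -/
def A.circleEquivUnits (X : A π) (hX : X.obj.fst.IsNaivelyIsotropic) (hc : X.obj.fst.IsComplexObj) :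
    Circle ≃* PreFrobenioid.unitsSubgroup (A.toElem π) X :=
  MulEquiv.ofBijective (A.circleToUnits π X hX hc) (A.circleToUnits_bijective π X hX hc)

/-- The underlying `C`-automorphism of `A.circleEquivUnits z` is `((id, 1, z), id)`.
[cite: MochizukiFrdII2008, Thm 3.6 (v) p.37] -/
theorem A.circleEquivUnits_apply_hom (X : A π) (hX : X.obj.fst.IsNaivelyIsotropic)
    (hc : X.obj.fst.IsComplexObj) (z : Circle) :
    ((A.circleEquivUnits π X hX hc z : PreFrobenioid.unitsSubgroup (A.toElem π) X) : Aut X).hom.hom =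
      (ArchFrd.unitAutOver π X.obj hX hc (Circle.toUnits z) (norm_coe_circle_toUnits z)).hom := rfl

/-- **Remark 3.6.1 for the angular Frobenioid `A`** (PROVED, over any base): for a complex isotropic
`X ∈ Ob(A)` and `x₀ ∈ ∂A_X`, under `S¹ ≅ O^×(X)` the orbit map `z ↦ z · x₀` is a topological embedding
`S¹ → ℂ^×` with image `∂A_X`. [cite: MochizukiFrdII2008, Rmk 3.6.1 p.39] -/
theorem rmk361_A : Rmk361_A π := by
  intro _ X hXc hXi x₀ hx₀
  have hX : X.obj.fst.IsNaivelyIsotropic := A.isNaivelyIsotropic_of_isIsotropic π X hXi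
  have hπ : (π.obj X.obj.snd).IsComplex := (D0.isComplex_toArchBase_iff _).mp hXc
  have hc : X.obj.fst.IsComplexObj := D0.isComplex_of_hom X.obj.iso.hom hπ
  refine ⟨(A.circleEquivUnits π X hX hc).symm, ?_⟩
  have hfun : (fun z : Circle => vMapA π
      (((A.circleEquivUnits π X hX hc).symm.symm z : PreFrobenioid.unitsSubgroup (A.toElem π) X) :
        Aut X).hom x₀) = fun z : Circle => Circle.toUnits z * x₀ := by
    funext z
    rw [MulEquiv.symm_symm]
    change vMap π (unitAutOver π X.obj hX hc (Circle.toUnits z) (norm_coe_circle_toUnits z)).hom x₀ = _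
    rw [vMap_of_mem_unitsSubgroup π X.obj _ (unitAutOver_mem π X.obj hX hc _ _)]
    rfl
  rw [hfun]
  exact ⟨(continuous_circle_mul x₀).isClosedEmbedding (circle_mul_injective x₀) |>.isEmbedding,
    range_circle_mul hX hx₀⟩

end ArchFrd

end

end Literature.AlgebraicGeometry.Frobenioids
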